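import Literature.Computability.Cryptography.PseudorandomFunctions
import Literature.Computability.Cryptography.Pseudorandomness
import Literature.Computability.Complexity.IterateFP
import Literature.Computability.Complexity.StringEquality
import Literature.Computability.Complexity.CoinTruncation
import Literature.Computability.Complexity.PairProjections
import Literature.Computability.Complexity.OracleClosure
import Literature.Computability.Complexity.OracleEmpty
import Literature.Computability.MetaComplexity.HeuristicClassesProofs
import HarnessLib

/-!
# The Goldreich–Goldwasser–Micali construction: pseudorandom functions from a length-doubling PRG

Trunk `CryptoQuantFine`, topic `Computability/Cryptography`; companion of
`PseudorandomFunctions.lean` (C4: `FunctionEnsemble`, `IsEfficientFamily`, `IsPRF`, `PRFExist`).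

`PseudorandomFunctions.lean` states the *unconditional* existence of length-preserving
pseudorandom function ensembles as the Prop `PRFExist`, whose docstring formerly carried the
locator "GGM 1986, Thm. 3" (a mis-attribution, since corrected there): `PRFExist` is an **open
existence hypothesis** (like its siblings `OWFExist`, `PRGExist`; it implies `OWFExist`, hence
`P ≠ NP`), whereas the Main Theorem of Goldreich–Goldwasser–Micali is the *conditional* statement

> GGM 1986, Thm. 3 (p. 800). Let `F` be a collection of functions constructed as in §3.2 using
> a CSB generator `G` (stretching `k`-bit seeds to `2k` bits). Then `F` passes all
> polynomial-time statistical tests for functions.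

(Goldreich 2001, Thm. 3.6.6: "Let `G` and `F` be as in Construction 3.6.5, and suppose that `G`
is a pseudorandom generator. Then `F` is an efficiently computable ensemble of pseudorandom
functions.") This file vendors that theorem *as printed*, i.e. about the explicit construction:

* `ggmStep G b s = G_b(s)` — the `|s|`-bit prefix (`b = 0`) / suffix (`b = 1`) of `G s`;
  `ggmEval G s x = G_{xₙ}(⋯ G_{x₂}(G_{x₁}(s)) ⋯)` (the walk down the GGM tree, root label `s`,
  edge path `x`); `ggmEnsemble G : FunctionEnsemble`, `(n, k, x) ↦ ggmEval G k x`
  (GGM 1986, §3.2; Goldreich 2001, Construction 3.6.5), with the length bookkeeping proved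
  (`length_ggmEval`: the labels keep the key length when `|G s| = 2|s|`);
* `IsLengthDoublingPRG G` — the hypothesis of the theorem: `G` is deterministic polynomial-time,
  `|G s| = 2|s|`, and `n ↦ G(U_n)` is pseudorandom against `U_{2n}` (Goldreich 2001, Def. 3.3.1
  with `ℓ(n) = 2n`; GGM's "CSB generator", single-string tests suffice by GGM 1986, Thm. 1 (Yao));
* **proved**: `polyTimeComputable_ggmEnsemble` — GGM 1986, §3.2–§3.3 (evaluating `f_k(x)`
  costs `|x|` evaluations of `G`; conditions 1–2 of a poly-random collection): the evaluation map
  `(n, k, x) ↦ f_k(x)` is polynomial-time computable on Mathlib's TM2 model, assembled from the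
  `CplxCore` string-function toolkit (no new Turing machine is programmed: one three-line
  finite-state transducer `GGM.dropSepT`, the tree's `EmptySim.headT`, `fanoutFn`, `mapFstFn`,
  `mapSndFn`, `truncSndFn`, `dropSndFn`, `swapFn`, `PrePost.selT`, `PrePost.tailT`, composition
  `comp_mem_FP` and the clocked-iteration combinator `iterate_mem_FP`); hence
  `isEfficientFamily_ggmEnsemble`;
* the named fact **`GGM1986_thm3`** (the Main Theorem: every PPT oracle adversary has
  negligible advantage in the PRF game against `ggmEnsemble G`) — the hybrid argument of
  GGM 1986, pp. 800–802, not formalised here;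
* **proved**: truncation by one symbol (`PRGTrunc.lift`, `IsPseudorandom.map_dropLast`,
  `IsPRG.dropLast`, `IsPRG.isPRG_dropLast`, `IsPRG.isLengthDoublingPRG_dropLast`): a PRG of stretch
  `2n + 1` in the prelude's sense `IsPRG` yields a length-doubling PRG; and
  `GGM.polyTimeComputable_two_mul_add_one` (the stretch `n ↦ 2n + 1` is unary-polynomial-time,
  the side condition of the stretch-extension fact);
* proved consequences: `isPRF_ggmEnsemble` (Goldreich 2001, Thm. 3.6.6, from the fact),
  `PRFExist_of_exists_isLengthDoublingPRG` (the existence corollary in the shape of Goldreich 2001,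
  Cor. 3.6.7/3.6.8: a length-doubling PRG yields `PRFExist`),
  `PRFExist_of_exists_isPRG_two_mul_add_one`, and `PRFExist_of_exists_isPRG_succ`: **`PRFExist`
  follows from a one-bit-stretch PRG (`∃ G, IsPRG G (· + 1)`) given exactly two named facts** —
  `Literature.Computability.Cryptography.exists_isPRG_of_stretch_succ` (Goldreich 2001, Thm. 3.3.3) and
  `GGM1986_thm3`.

## Relation to other files

* Not to be confused with `Literature/Computability/MetaComplexity/GGM.lean`
  (`Literature.Computability.MetaComplexity.ggmLab`, `hybLab`, `exists_distinguisher`, …): that file is the *finite,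
  circuit-model* GGM tree (straight-line `B₂` circuits, one seed length and one depth, exact
  counts) with the Razborov–Rudich hybrid argument, serving the natural-proofs barrier. The
  present file is the *uniform, asymptotic* `PMF`/oracle-machine version over the prelude's
  `IsPRG`/`IsPRF` (bit strings, `PolyTimeComputable`, PPT `RandAlg`/`OracleAdversary`). The
  objects are different and nothing there is reusable for `GGM1986_thm3` as stated here (its
  hybrid bookkeeping is, of course, the combinatorial pattern the printed proof follows).
* Imports: `Complexity/OracleEmpty.lean` supplies the transducer `EmptySim.headT`
  (`b :: l ↦ [b]`) and `Complexity/OracleClosure.lean` the selector/tail transducers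
  `PrePost.selT`, `PrePost.tailT`; `MetaComplexity/HeuristicClassesProofs.lean` is imported only
  for three generic lemmas that happen to live there — `PolyTimeComputable.of_comp_encode`,
  `polynomial_eval_mono` (both in `Literature.CplxCore`) and
  `Literature.Computability.MetaComplexity.map_take_uniformOfFintype_vector` (a prefix of a uniform string is uniform); a
  librarian lift of these into `Complexity/` would remove the cross-trunk import.

## Design notes

* `G₀`/`G₁` cut `G s` at `|s|` (Goldreich's Construction 3.6.5 verbatim), not at the security
  parameter, so `ggmEval` never needs `n` and label lengths are preserved on *all* keys; this is
  what keeps the evaluation polynomial-time on ill-formed inputs as well (`length_ggmEval`).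
* `IsLengthDoublingPRG` is not phrased as `IsPRG G (fun n => 2 * n)`: the prelude's `IsPRG`
  demands the expansion `n < ℓ n` for *every* `n`, which fails at `n = 0` for `ℓ n = 2n`
  (Goldreich's Def. 3.3.1 has the same clause and tacitly ignores `n = 0`). The three remaining
  clauses of `IsPRG` are kept literally.
* Efficiency (GGM §3.3, first sentence; the `k · T_k` step count of §3.2) is proved; the
  machine content is the string function `GGM.evalFn G`: project `⟨1ⁿ, ⟨k, x⟩⟩ ↦ ⟨k, x⟩`, swap to
  `⟨x, k⟩`, run `|x|` rounds of `GGM.roundFn G : ⟨b :: x', s⟩ ↦ ⟨x', G_b(s)⟩`, project. The round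
  function precomputes both halves `⟨G₀(s), G₁(s)⟩` and selects with `PrePost.selT`; it is
  *clamped* to the length of its argument (`GGM.clampFn`, `(F w) ↾ |w|`, transparent on
  well-formed states) so that the additive-growth hypothesis of `iterate_mem_FP` holds on every
  word without analysing the toolkit functions off their specified inputs.
* `GGM1986_thm3` is the hybrid argument of GGM 1986, pp. 800–802 (level hybrids `A_i`, lazy
  sampling of the random function, the string test `A_T` on polynomially many samples, Thm. 1);
  its formalisation needs a PPT `RandAlg` simulating an arbitrary `OracleAdversary` and is left
  as a named fact. Model remark: its hypothesis quantifies over the prelude's PPT distinguishers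
  (`RandAlg.IsPolyTime`: polynomially *bounded* coin budget), its conclusion over
  `OracleAdversary` (polynomial coin budget), exactly as `IsPRG`/`IsPRF` do; the statement is
  implied by the printed one.
* The truncation reduction shifts the coin budget, `coinLen' L = coinLen (L - 1)`: the prelude's
  PPT distinguishers (`RandAlg.IsPolyTime`) have a merely polynomially *bounded* (not necessarily
  computable) coin budget read off the input length, so a reduction that changes the input length
  must reproduce the coin count as a function of the new length alone; truncation by one symbol
  shrinks the game input `⟨1ⁿ, sample⟩` by exactly one. For the same reason a reduction from an
  *arbitrary* stretch `ℓ` to stretch `n + 1` (which would close the gap to `PRGExist`) is not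
  attempted: it would need `n ↦ 2n + 2 + ℓ(n)` to be injective.
* Nothing here weakens or restates `PRFExist`; the unconditional Prop keeps its meaning.

## References

* O. Goldreich, S. Goldwasser, S. Micali, *How to construct random functions*, J. ACM 33 (1986)
  792–807: §2.1–2.2 (CSB generators, Thm. 1), §3.1 (statistical tests for functions), §3.2 (the
  construction), §3.3 Thm. 3 (Main Theorem) with its proof pp. 800–802.
* O. Goldreich, *Foundations of Cryptography I: Basic Tools*, CUP 2001: Def. 3.3.1, §3.6.2
  Construction 3.6.5, Thm. 3.6.6, Cor. 3.6.7, Cor. 3.6.8.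
* O. Goldreich, *Foundations of Cryptography I*, §3.3.2–3.3.3 (stretch extension, Construction
  3.3.2, Thm. 3.3.3; prefixes of pseudorandom sequences).
* S. Arora, B. Barak, *Computational Complexity: A Modern Approach*, CUP 2009, §0.1 (pairing),
  §1.3 (machine composition), §1.4.1 (clocked simulation), Def. 7.1–7.3 (probabilistic machines)
  — the toolkit lemmas used in the machine arguments.
* J. E. Hopcroft, J. D. Ullman, *Introduction to Automata Theory, Languages, and Computation*,
  1979, §2.7 (Mealy machines) — finite-state transducers.
-/

namespace Literature.Computability.Cryptography

open Filter Asymptotics _root_.Computability Complexity MetaComplexity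

/-! ### The construction -/

/-- `ggmStep G b s = G_b(s)`: for `b = false` the `|s|`-bit prefix `G₀(s)` of `G s`, for
`b = true` the `|s|`-bit suffix `G₁(s)` (so `G s = G₀(s) ‖ G₁(s)` when `|G s| = 2|s|`).
[GGM 1986, §3.2; Goldreich 2001, Construction 3.6.5] [cite: Goldreich2001, Construction 3.6.5] -/
def ggmStep (G : List Bool → List Bool) (b : Bool) (s : List Bool) : List Bool :=
  bif b then (G s).drop s.length else (G s).take s.length

/-- `ggmEval G s x = G_{xₙ}(⋯ G_{x₂}(G_{x₁}(s)) ⋯)`: the label of the leaf reached from the root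
(labelled `s`) along the edge path `x = x₁ x₂ ⋯ xₙ` in the GGM tree (`x₁` is applied first).
[GGM 1986, §3.2 (`f_x(y) = G_y(x)`); Goldreich 2001, Construction 3.6.5] [cite: GGM1986, §3.2] -/
def ggmEval (G : List Bool → List Bool) (s x : List Bool) : List Bool :=
  x.foldl (fun t b => ggmStep G b t) s

/-- The GGM function ensemble of `G`: `ggmEnsemble G n k x = f_k(x) = ggmEval G k x`, key `k`,
argument `x` (intended `|k| = |x| = n`; the security parameter is not otherwise used).
[GGM 1986, §3.2 (`F_k = {f_x}_{x ∈ I_k}`); Goldreich 2001, Construction 3.6.5] [cite: GGM1986, §3.2] -/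
def ggmEnsemble (G : List Bool → List Bool) : FunctionEnsemble :=
  fun _ k x => ggmEval G k x

/-- `G₀(s)` is the `|s|`-prefix of `G s` (definitional). [Goldreich 2001, Construction 3.6.5] [cite: Goldreich2001, Construction 3.6.5] -/
@[simp] theorem ggmStep_false (G : List Bool → List Bool) (s : List Bool) :
    ggmStep G false s = (G s).take s.length :=
  rfl

/-- `G₁(s)` is the `|s|`-suffix of `G s` (definitional). [Goldreich 2001, Construction 3.6.5] [cite: Goldreich2001, Construction 3.6.5] -/
@[simp] theorem ggmStep_true (G : List Bool → List Bool) (s : List Bool) :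
    ggmStep G true s = (G s).drop s.length :=
  rfl

/-- For a length-doubling `G`, `G s = G₀(s) ++ G₁(s)`. [Goldreich 2001, Construction 3.6.5] [cite: Goldreich2001, Construction 3.6.5] -/
theorem ggmStep_false_append_ggmStep_true (G : List Bool → List Bool) (s : List Bool) :
    ggmStep G false s ++ ggmStep G true s = G s :=
  List.take_append_drop _ _

/-- `G₀`, `G₁` preserve the label length when `|G s| = 2|s|`. [Goldreich 2001, Construction 3.6.5] [cite: Goldreich2001, Construction 3.6.5] -/
theorem length_ggmStep {G : List Bool → List Bool} (hG : ∀ s, (G s).length = 2 * s.length)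
    (b : Bool) (s : List Bool) : (ggmStep G b s).length = s.length := by
  cases b
  · simp only [ggmStep_false, List.length_take, hG s]
    omega
  · simp only [ggmStep_true, List.length_drop, hG s]
    omega

/-- The empty path stays at the root: `ggmEval G s [] = s`. [GGM 1986, §3.2 (footnote 5: `G_λ(x) = x`)] [cite: GGM1986, §3.2] -/
@[simp] theorem ggmEval_nil (G : List Bool → List Bool) (s : List Bool) : ggmEval G s [] = s :=
  rfl

/-- First edge first: `ggmEval G s (b :: x) = ggmEval G (G_b(s)) x`. [GGM 1986, §3.2] [cite: GGM1986, §3.2] -/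
@[simp] theorem ggmEval_cons (G : List Bool → List Bool) (s : List Bool) (b : Bool)
    (x : List Bool) : ggmEval G s (b :: x) = ggmEval G (ggmStep G b s) x :=
  rfl

/-- Last edge last: `ggmEval G s (x ++ [b]) = G_b(ggmEval G s x)` (the outermost application in
`G_{xₙ}(⋯G_{x₁}(s)⋯)`). [GGM 1986, §3.2; Goldreich 2001, Construction 3.6.5] [cite: GGM1986, §3.2] -/
theorem ggmEval_append_singleton (G : List Bool → List Bool) (s x : List Bool) (b : Bool) :
    ggmEval G s (x ++ [b]) = ggmStep G b (ggmEval G s x) := by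
  simp [ggmEval, List.foldl_append]

/-- Paths compose: `ggmEval G s (x ++ y) = ggmEval G (ggmEval G s x) y`. [GGM 1986, §3.2] [cite: GGM1986, §3.2] -/
theorem ggmEval_append (G : List Bool → List Bool) (s x y : List Bool) :
    ggmEval G s (x ++ y) = ggmEval G (ggmEval G s x) y := by
  simp [ggmEval, List.foldl_append]

/-- All labels of the GGM tree have the length of the root label when `|G s| = 2|s|`.
[Goldreich 2001, Construction 3.6.5 (`f_s : {0,1}ⁿ → {0,1}ⁿ`)] [cite: Goldreich2001, Construction 3.6.5] -/
theorem length_ggmEval {G : List Bool → List Bool} (hG : ∀ s, (G s).length = 2 * s.length)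
    (s x : List Bool) : (ggmEval G s x).length = s.length := by
  induction x generalizing s with
  | nil => rfl
  | cons b x ih => rw [ggmEval_cons, ih, length_ggmStep hG]

/-- Unfolding lemma for the ensemble. [GGM 1986, §3.2] [cite: GGM1986, §3.2] -/
@[simp] theorem ggmEnsemble_apply (G : List Bool → List Bool) (n : ℕ) (k x : List Bool) :
    ggmEnsemble G n k x = ggmEval G k x :=
  rfl

/-- The GGM ensemble is length-preserving: `|f_k(x)| = |k|`, in particular `= n` on well-formed
keys. [GGM 1986, §3 (`f : I_k → I_k`); Goldreich 2001, Construction 3.6.5] [cite: GGM1986, §3.2] -/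
theorem length_ggmEnsemble {G : List Bool → List Bool} (hG : ∀ s, (G s).length = 2 * s.length)
    (n : ℕ) (k x : List Bool) : (ggmEnsemble G n k x).length = k.length :=
  length_ggmEval hG k x

/-! ### The hypothesis: a length-doubling pseudorandom generator -/

/-- `IsLengthDoublingPRG G`: `G` is a *length-doubling pseudorandom generator* — deterministic
polynomial-time computable, `|G s| = 2|s|` for every seed, and the ensemble `n ↦ G(U_n)` is
pseudorandom (computationally indistinguishable from `n ↦ U_{2n}` by PPT distinguishers). This is
the prelude's `IsPRG G ℓ` for `ℓ n = 2n` without the expansion clause `∀ n, n < ℓ n` (which fails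
only at `n = 0`); it is GGM's "CSB generator that stretches a seed `x ∈ I_k` into a `2k`-bit
sequence" (next-bit tests ⇔ single-string statistical tests, GGM 1986, Thm. 1 (Yao)).
[Goldreich 2001, Def. 3.3.1 with Construction 3.6.5 (`G` expands `n` bits to `2n`); GGM 1986,
§2.1–2.2, §3.2] [cite: Goldreich2001, Def. 3.3.1 and Construction 3.6.5] -/
def IsLengthDoublingPRG (G : List Bool → List Bool) : Prop :=
  PolyTimeComputable (id : List Bool → List Bool) (id : List Bool → List Bool) G ∧
    (∀ s, (G s).length = 2 * s.length) ∧
      IsPseudorandom (fun n => (uniformBits n).map G) (fun n => 2 * n)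

/-- A length-doubling PRG is polynomial-time computable (projection). [Goldreich 2001, Def. 3.3.1] [cite: Goldreich2001, Def. 3.3.1] -/
theorem IsLengthDoublingPRG.polyTimeComputable {G : List Bool → List Bool}
    (h : IsLengthDoublingPRG G) : PolyTimeComputable (id : List Bool → List Bool) id G :=
  h.1

/-- A length-doubling PRG doubles lengths (projection). [Goldreich 2001, Construction 3.6.5] [cite: Goldreich2001, Construction 3.6.5] -/
theorem IsLengthDoublingPRG.length_eq {G : List Bool → List Bool} (h : IsLengthDoublingPRG G)
    (s : List Bool) : (G s).length = 2 * s.length :=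
  h.2.1 s

/-- A length-doubling PRG has a pseudorandom output ensemble (projection). [Goldreich 2001, Def. 3.3.1] [cite: Goldreich2001, Def. 3.3.1] -/
theorem IsLengthDoublingPRG.isPseudorandom {G : List Bool → List Bool}
    (h : IsLengthDoublingPRG G) :
    IsPseudorandom (fun n => (uniformBits n).map G) (fun n => 2 * n) :=
  h.2.2

/-! ### Efficiency of the construction (GGM 1986, §3.2–§3.3), proved

The evaluation map `(n, k, x) ↦ f_k(x)` is polynomial-time computable: the string function
`GGM.evalFn G` below computes it on the encoding `⟨1ⁿ, ⟨k, x⟩⟩` and is in `FP`, being a composite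
of toolkit functions and `|x|` clocked rounds of a clamped round function. -/

namespace GGM

/-! #### A small transducer (the tree's `EmptySim.headT` supplies `b :: l ↦ [b]`) -/

/-- States of `dropSepT`: copy two symbols, drop two symbols, copy the rest. [folklore] -/
inductive DS
  | c0
  | c1
  | d0
  | d1
  | copy
  deriving DecidableEq, Fintype

/-- Transition of `dropSepT`. [folklore] -/
def dropSepStep : DS → Bool → DS × List Bool
  | .c0, b => (.c1, [b])
  | .c1, b => (.d0, [b])
  | .d0, _ => (.d1, [])
  | .d1, _ => (.copy, [])
  | .copy, b => (.copy, [b])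

/-- The transducer deleting the 3rd and 4th symbol: on `⟨[t], w⟩ = t t 0 1 w` it outputs
`t t w`, i.e. `⟨[t], ⟨P, R⟩⟩ ↦ ⟨t :: P, R⟩` (`dropSepT_eval_boolPair`). [folklore] -/
def dropSepT : FST DS Bool Bool where
  init := .c0
  step := dropSepStep
  front := fun _ => []
  keep := fun _ => true

/-- The transition of `dropSepT` (definitional). [folklore] -/
@[simp] theorem dropSepT_step (s : DS) (b : Bool) : dropSepT.step s b = dropSepStep s b := rfl

/-- The copier of `dropSepT`. [folklore] -/
theorem dropSepT_run_copy (l : List Bool) : (dropSepT.run .copy l).2 = l := by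
  induction l with
  | nil => rfl
  | cons b l ih => simp [FST.run_cons, dropSepStep, ih]

/-- **`dropSepT ⟨[t], ⟨P, R⟩⟩ = ⟨t :: P, R⟩`.** [folklore] -/
theorem dropSepT_eval_boolPair (t : Bool) (P R : List Bool) :
    dropSepT.eval (boolPair [t] (boolPair P R)) = boolPair (t :: P) R := by
  have he : ∀ l, dropSepT.eval l = (dropSepT.run .c0 l).2 := fun l => by simp [FST.eval, dropSepT]
  have h1 : boolPair [t] (boolPair P R) = t :: t :: false :: true :: boolPair P R := by
    simp [boolPair]
  have h2 : boolPair (t :: P) R = t :: t :: boolPair P R := by simp [boolPair]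
  rw [he, h1, h2]
  simp [FST.run_cons, dropSepStep, dropSepT_run_copy]

/-- The identity string function is in `FP` (Mathlib's identity machine). [folklore] -/
theorem id_mem_FP' : (fun z : List Bool => z) ∈ FP := PolyTimeComputable.id _

/-! ### Clamping a string function to the length of its argument -/

/-- `clampFn F w = (F w) ↾ |w|`, as the composite `snd ∘ trunc_X ∘ ⟨id, F⟩`. Two uses: with
`F = G` it is the first half `G₀` of a length-doubling generator (`clampFn_apply`,
`ggmStep_false`), and around the round function it makes the additive-growth hypothesis of the
iteration combinator hold on *every* word. [folklore] -/
noncomputable def clampFn (F : List Bool → List Bool) : List Bool → List Bool :=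
  (fun z => (boolUnpair z).2) ∘ truncSndFn Polynomial.X ∘ fanoutFn (fun z => z) F

/-- `clampFn F w = (F w) ↾ |w|` on every word. [folklore] -/
theorem clampFn_apply (F : List Bool → List Bool) (w : List Bool) :
    clampFn F w = (F w).take w.length := by
  simp [clampFn, truncSndFn_boolPair]

/-- The clamped function has additive growth `0`. [folklore] -/
theorem length_clampFn_le (F : List Bool → List Bool) (w : List Bool) :
    (clampFn F w).length ≤ w.length + 0 := by
  rw [clampFn_apply, List.length_take]; omega

/-- `clampFn F ∈ FP` for `F ∈ FP`. [Arora–Barak 2009, §1.3] [cite: AroraBarak2009, §1.3] -/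
theorem clampFn_mem_FP {F : List Bool → List Bool} (hF : F ∈ FP) : clampFn F ∈ FP :=
  comp_mem_FP boolUnpairSnd_mem_FP
    (comp_mem_FP (truncSndFn_mem_FP _) (fanoutFn_mem_FP id_mem_FP' hF))

/-! ### The second half of `G` as a string function (the first half is `clampFn G`) -/

/-- `half₁ G s = G₁(s) = (G s)` minus its first `|s|` symbols, as `snd ∘ drop_X ∘ ⟨id, G⟩`. [folklore] -/
noncomputable def half₁ (G : List Bool → List Bool) : List Bool → List Bool :=
  (fun z => (boolUnpair z).2) ∘ dropSndFn Polynomial.X ∘ fanoutFn (fun z => z) G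

/-- `half₁ G s = G₁(s)` on every string. [Goldreich 2001, Construction 3.6.5] [cite: Goldreich2001, Construction 3.6.5] -/
theorem half₁_apply (G : List Bool → List Bool) (s : List Bool) :
    half₁ G s = ggmStep G true s := by
  simp [half₁, dropSndFn_boolPair]

/-- `half₁ G ∈ FP` for `G ∈ FP`. [Arora–Barak 2009, Thm. 2.8 (proof: composition)] [cite: AroraBarak2009, §1.3] -/
theorem half₁_mem_FP {G : List Bool → List Bool} (hG : G ∈ FP) : half₁ G ∈ FP :=
  comp_mem_FP boolUnpairSnd_mem_FP
    (comp_mem_FP (dropSndFn_mem_FP _) (fanoutFn_mem_FP id_mem_FP' hG))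

/-! ### One round of the tree walk -/

/-- `stepFn G ⟨b :: x, s⟩ = G_b(s)`: isolate the edge bit, precompute both halves `⟨G₀(s), G₁(s)⟩ = ⟨clampFn G s, half₁ G s⟩`, select.
[folklore] -/
noncomputable def stepFn (G : List Bool → List Bool) : List Bool → List Bool :=
  PrePost.tailT.eval ∘ PrePost.selT.eval ∘ dropSepT.eval ∘
    mapSndFn (fanoutFn (clampFn G) (half₁ G)) ∘ mapFstFn EmptySim.headT.eval

/-- **`stepFn G ⟨b :: x, s⟩ = G_b(s)`.** [GGM 1986, §3.2] [cite: GGM1986, §3.2] -/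
theorem stepFn_boolPair_cons (G : List Bool → List Bool) (b : Bool) (x s : List Bool) :
    stepFn G (boolPair (b :: x) s) = ggmStep G b s := by
  simp only [stepFn, Function.comp_apply, mapFstFn_boolPair, EmptySim.headT_eval_cons, mapSndFn_boolPair,
    fanoutFn_apply, clampFn_apply, half₁_apply, dropSepT_eval_boolPair]
  cases b
  · rw [PrePost.selT_eval_false, PrePost.tailT_eval_cons, ggmStep_false]
  · rw [PrePost.selT_eval_true, PrePost.tailT_eval_cons, ggmStep_true]

/-- `stepFn G ∈ FP` for `G ∈ FP`. [Arora–Barak 2009, §1.3] [cite: AroraBarak2009, §1.3] -/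
theorem stepFn_mem_FP {G : List Bool → List Bool} (hG : G ∈ FP) : stepFn G ∈ FP :=
  comp_mem_FP PrePost.tailT.polyTimeComputable_eval
    (comp_mem_FP PrePost.selT.polyTimeComputable_eval
      (comp_mem_FP dropSepT.polyTimeComputable_eval
        (comp_mem_FP (mapSndFn_mem_FP (fanoutFn_mem_FP (clampFn_mem_FP hG) (half₁_mem_FP hG)))
          (mapFstFn_mem_FP EmptySim.headT.polyTimeComputable_eval))))

/-- `roundFn₀ G ⟨b :: x, s⟩ = ⟨x, G_b(s)⟩` (unclamped round function). [folklore] -/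
noncomputable def roundFn₀ (G : List Bool → List Bool) : List Bool → List Bool :=
  fanoutFn (PrePost.tailT.eval ∘ fun z => (boolUnpair z).1) (stepFn G)

/-- **`roundFn₀ G ⟨b :: x, s⟩ = ⟨x, G_b(s)⟩`.** [GGM 1986, §3.2] [cite: GGM1986, §3.2] -/
theorem roundFn₀_boolPair_cons (G : List Bool → List Bool) (b : Bool) (x s : List Bool) :
    roundFn₀ G (boolPair (b :: x) s) = boolPair x (ggmStep G b s) := by
  simp only [roundFn₀, fanoutFn_apply, Function.comp_apply, boolUnpair_boolPair,
    PrePost.tailT_eval_cons, stepFn_boolPair_cons]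

/-- `roundFn₀ G ∈ FP` for `G ∈ FP`. [Arora–Barak 2009, §1.3] [cite: AroraBarak2009, §1.3] -/
theorem roundFn₀_mem_FP {G : List Bool → List Bool} (hG : G ∈ FP) : roundFn₀ G ∈ FP :=
  fanoutFn_mem_FP (comp_mem_FP PrePost.tailT.polyTimeComputable_eval boolUnpairFst_mem_FP)
    (stepFn_mem_FP hG)

/-- The round function of the walk: `roundFn G ⟨b :: x, s⟩ = ⟨x, G_b(s)⟩`, clamped. [folklore] -/
noncomputable def roundFn (G : List Bool → List Bool) : List Bool → List Bool :=
  clampFn (roundFn₀ G)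

/-- **One round of the walk**: `roundFn G ⟨b :: x, s⟩ = ⟨x, G_b(s)⟩` when `|G s| = 2|s|` (the clamp is transparent: the state shrinks by two symbols). [GGM 1986, §3.2] [cite: GGM1986, §3.2] -/
theorem roundFn_boolPair_cons {G : List Bool → List Bool} (hG : ∀ s, (G s).length = 2 * s.length)
    (b : Bool) (x s : List Bool) : roundFn G (boolPair (b :: x) s) = boolPair x (ggmStep G b s) := by
  rw [roundFn, clampFn_apply, roundFn₀_boolPair_cons]
  apply List.take_of_length_le
  simp only [length_boolPair, List.length_cons, length_ggmStep hG]
  omega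

/-- **`|x|` rounds walk the whole path**: `(roundFn G)^[|x|] ⟨x, k⟩ = ⟨[], f_k(x)⟩`. [GGM 1986, §3.2 (`f_x(y)` costs `k` evaluations of `G`)] [cite: GGM1986, §3.2] -/
theorem iterate_roundFn {G : List Bool → List Bool} (hG : ∀ s, (G s).length = 2 * s.length)
    (x : List Bool) : ∀ k : List Bool,
      (roundFn G)^[x.length] (boolPair x k) = boolPair [] (ggmEval G k x) := by
  induction x with
  | nil => intro k; rfl
  | cons b x ih =>
    intro k
    rw [List.length_cons, Function.iterate_succ_apply, roundFn_boolPair_cons hG, ih, ggmEval_cons]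

/-! ### The evaluation map -/

/-- `evalFn G ⟨u, ⟨k, x⟩⟩ = ggmEval G k x`: project, swap to `⟨x, k⟩`, walk `|x|` rounds, project.
[folklore] -/
noncomputable def evalFn (G : List Bool → List Bool) : List Bool → List Bool :=
  (fun z => (boolUnpair z).2) ∘
    (fun z => (roundFn G)^[(Polynomial.X : Polynomial ℕ).eval (boolUnpair z).1.length] z) ∘
      swapFn ∘ fun z => (boolUnpair z).2

/-- **`evalFn G ⟨u, ⟨k, x⟩⟩ = f_k(x)`** (for any first component `u`, in particular `u = 1ⁿ`). [GGM 1986, §3.2] [cite: GGM1986, §3.2] -/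
theorem evalFn_apply {G : List Bool → List Bool} (hG : ∀ s, (G s).length = 2 * s.length)
    (u k x : List Bool) : evalFn G (boolPair u (boolPair k x)) = ggmEval G k x := by
  simp only [evalFn, Function.comp_apply, boolUnpair_boolPair, swapFn_boolPair, Polynomial.eval_X,
    iterate_roundFn hG]

/-- **`evalFn G ∈ FP` for `G ∈ FP`**: `|x| = X(|x|)` clocked rounds of the clamped round function (`iterate_mem_FP`) between polynomial-time projections and a swap. [GGM 1986, §3.3 (condition 2, poly-time evaluation); Arora–Barak 2009, §1.4.1 (clocked iteration)] [cite: GGM1986, §3.3 (condition 2)] -/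
theorem evalFn_mem_FP {G : List Bool → List Bool} (hG : G ∈ FP) : evalFn G ∈ FP :=
  comp_mem_FP boolUnpairSnd_mem_FP
    (comp_mem_FP (iterate_mem_FP (clampFn_mem_FP (roundFn₀_mem_FP hG)) 0
        (length_clampFn_le (roundFn₀ G)) Polynomial.X)
      (comp_mem_FP swapFn_mem_FP boolUnpairSnd_mem_FP))

end GGM

/-- **GGM, efficiency of the construction** (conditions 1–2 of a poly-random collection). For a
polynomial-time `G`, the evaluation map `(n, k, x) ↦ f_k(x)` of the GGM ensemble is
polynomial-time computable on the encoding `boolPair 1ⁿ (boolPair k x)` (Mathlib's TM2 model):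
computing `f_k(x)` takes `|x|` evaluations of `G` on `|k|`-bit labels ("computing `f_x(y)` …
requires `k · T_k` steps"). The machine is that of `GGM.evalFn G` (`GGM.evalFn_mem_FP`,
`GGM.evalFn_apply`). [GGM 1986, §3.2 (step count) and §3.3, first paragraph; Goldreich 2001,
proof of Thm. 3.6.6 ("Clearly, the ensemble `F` is efficiently computable")] [cite: GGM1986, §3.2–§3.3 (conditions 1–2)] -/
theorem polyTimeComputable_ggmEnsemble {G : List Bool → List Bool}
    (hc : PolyTimeComputable (id : List Bool → List Bool) (id : List Bool → List Bool) G)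
    (hl : ∀ s, (G s).length = 2 * s.length) :
    PolyTimeComputable
      (fun p : ℕ × List Bool × List Bool => boolPair (unaryEncodeNat p.1) (boolPair p.2.1 p.2.2))
      (id : List Bool → List Bool) (fun p => ggmEnsemble G p.1 p.2.1 p.2.2) := by
  obtain ⟨p, M, hM⟩ := GGM.evalFn_mem_FP hc
  refine ⟨p, M, fun a => ?_⟩
  have h := hM (boolPair (unaryEncodeNat a.1) (boolPair a.2.1 a.2.2))
  simp only [id, GGM.evalFn_apply hl] at h
  exact h

/-- The GGM ensemble of a polynomial-time length-doubling `G` is an efficiently computable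
function ensemble with `κ = ℓin = ℓout = id` (machine: `polyTimeComputable_ggmEnsemble`; the
polynomial bound on the length functions is `X`; the length discipline is `length_ggmEnsemble`).
[GGM 1986, §3.3 (conditions 1–2); Goldreich 2001, Def. 3.6.3, Construction 3.6.5] [cite: GGM1986, §3.3 (conditions 1–2)] -/
theorem isEfficientFamily_ggmEnsemble {G : List Bool → List Bool}
    (hc : PolyTimeComputable (id : List Bool → List Bool) (id : List Bool → List Bool) G)
    (hl : ∀ s, (G s).length = 2 * s.length) : IsEfficientFamily (ggmEnsemble G) id id id := by
  refine ⟨polyTimeComputable_ggmEnsemble hc hl, ⟨Polynomial.X, fun n => ?_⟩, fun n k x hk _ => ?_⟩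
  · simp
  · rw [length_ggmEnsemble hl, hk, id]

/-! ### From a PRG of stretch `2n + 1` to a length-doubling PRG: truncation by one symbol

If `G` is a pseudorandom generator with stretch `ℓ(n) = ℓ'(n) + 1` then `s ↦ G(s)` *without its
last symbol* keeps the three substantive clauses of `IsPRG` for the stretch `ℓ'`. The reduction
`PRGTrunc.lift D` runs a distinguisher `D` of the truncated ensemble on the untruncated sample
minus its last symbol, with the coin budget *shifted by one* (`coinLen' L = coinLen (L - 1)`):
the prelude's PPT distinguishers have a merely polynomially *bounded* coin budget read off the
input length, so a reduction changing the input length must reproduce `D`'s coin count as a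
function of the new length alone — here the game input `⟨1ⁿ, sample⟩` shrinks by exactly one.
(A reduction from an *arbitrary* stretch `ℓ` to stretch `n + 1` would need `n ↦ 2n + 2 + ℓ(n)`
injective and is not attempted.) Everything in this section is proved. -/

namespace PRGTrunc

/-! ### Dropping the last symbol is polynomial time -/

/-- States of `dropLastT`: empty buffer / one buffered symbol. [folklore] -/
inductive DL
  | empty
  | buf (b : Bool)
  deriving DecidableEq, Fintype

/-- Transition of `dropLastT`: emit the buffered symbol, buffer the new one. [folklore] -/
def dlStep : DL → Bool → DL × List Bool
  | .empty, b => (.buf b, [])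
  | .buf c, b => (.buf b, [c])

/-- The transducer `l ↦ l.dropLast` (a one-symbol delay line whose buffer is discarded at the
end). [Hopcroft–Ullman 1979, §2.7 (Mealy machines)] [folklore] -/
def dropLastT : FST DL Bool Bool where
  init := .empty
  step := dlStep
  front := fun _ => []
  keep := fun _ => true

/-- The transition of `dropLastT` (definitional). [folklore] -/
@[simp] theorem dropLastT_step (s : DL) (b : Bool) : dropLastT.step s b = dlStep s b := rfl

/-- With `c` buffered, `dropLastT` emits `(c :: l).dropLast` on `l`. [folklore] -/
theorem dropLastT_run_buf (c : Bool) (l : List Bool) :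
    (dropLastT.run (.buf c) l).2 = (c :: l).dropLast := by
  induction l generalizing c with
  | nil => rfl
  | cons b l ih => rw [FST.run_cons, dropLastT_step, dlStep, ih, List.dropLast_cons_cons]; rfl

/-- **`dropLastT` computes `List.dropLast`.** [folklore] -/
theorem dropLastT_eval (l : List Bool) : dropLastT.eval l = l.dropLast := by
  have he : dropLastT.eval l = (dropLastT.run .empty l).2 := by simp [FST.eval, dropLastT]
  rw [he]
  cases l with
  | nil => rfl
  | cons b l => rw [FST.run_cons, dropLastT_step, dlStep, dropLastT_run_buf]; rfl

/-- **`List.dropLast ∈ FP`.** [Arora–Barak 2009, §1.3 (finite control)] [cite: AroraBarak2009, §1.3] -/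
theorem dropLast_mem_FP : (fun l : List Bool => l.dropLast) ∈ FP := by
  have h : (fun l : List Bool => l.dropLast) = dropLastT.eval := funext fun l => (dropLastT_eval l).symm
  rw [h]
  exact dropLastT.polyTimeComputable_eval

/-- Post-composing a polynomial-time `G` with `dropLast` stays polynomial time.
[Arora–Barak 2009, Thm. 2.8 (proof: composition)] [cite: AroraBarak2009, §1.3] -/
theorem polyTimeComputable_dropLast_comp {G : List Bool → List Bool}
    (hG : PolyTimeComputable (id : List Bool → List Bool) (id : List Bool → List Bool) G) :
    PolyTimeComputable (id : List Bool → List Bool) (id : List Bool → List Bool)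
      (fun s => (G s).dropLast) :=
  PolyTimeComputable.comp_holds dropLast_mem_FP hG

/-! ### The reduction -/

/-- `lift D`: run `D` on the input without its last symbol, with the coin budget shifted by one
(`coinLen' L = coinLen (L - 1)`), so that `lift D` on `x` draws exactly the coins `D` draws on
`x.dropLast`. [Goldreich 2001, §3.3 (reductions between distinguishers); Arora–Barak 2009,
Def. 7.1] [folklore] -/
def lift (D : RandAlg (List Bool) Bool) : RandAlg (List Bool) Bool where
  run x r := D.run x.dropLast r
  coinLen L := D.coinLen (L - 1)

/-- Uniform coins pushed through the same reader agree when the coin counts agree (transport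
along `k = k'`; the `Nonempty` instances are proof-irrelevant). [folklore] -/
theorem map_uniformVector_congr (f : List Bool → Bool) {k k' : ℕ} (h : k = k')
    [Nonempty (List.Vector Bool k)] [Nonempty (List.Vector Bool k')] :
    (PMF.uniformOfFintype (List.Vector Bool k)).map (fun r => f r.toList) =
      (PMF.uniformOfFintype (List.Vector Bool k')).map (fun r => f r.toList) := by
  subst h
  rfl

/-- **The output law of `lift D` on `x` is that of `D` on `x.dropLast`.** [folklore] -/
theorem outputPMF_lift (D : RandAlg (List Bool) Bool) (x : List Bool) :
    (lift D).outputPMF id x = D.outputPMF id x.dropLast := by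
  unfold RandAlg.outputPMF
  exact map_uniformVector_congr (D.run x.dropLast) (by simp [lift, List.length_dropLast])

/-- **`lift D` is PPT when `D` is**: its run map is the machine of `D` after the polynomial-time
preprocessing `⟨x, r⟩ ↦ ⟨x.dropLast, r⟩` (`mapFstFn`), and its coin budget is bounded by the same
polynomial (`ℕ`-polynomials are monotone). [Arora–Barak 2009, Thm. 2.8 (proof), Def. 7.3] [cite: AroraBarak2009, §1.3] -/
theorem isPPT_lift {D : RandAlg (List Bool) Bool} (hD : IsPPT D encodeBool) :
    IsPPT (lift D) encodeBool := by
  refine ⟨?_, ?_⟩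
  · have hpre : PolyTimeComputable (fun p : List Bool × List Bool => boolPair (id p.1) p.2)
        (fun p : List Bool × List Bool => boolPair (id p.1) p.2)
        (fun p : List Bool × List Bool => (p.1.dropLast, p.2)) :=
      (mapFstFn_mem_FP dropLast_mem_FP).of_comp_encode (fun p => boolPair p.1 p.2)
        (fun _ => rfl) (fun p => by simp)
    have h := PolyTimeComputable.comp_holds hD.1 hpre
    exact h
  · obtain ⟨p, hp⟩ := hD.2
    exact ⟨p, fun n => (hp (n - 1)).trans (polynomial_eval_mono p (Nat.sub_le n 1))⟩

/-! ### Distributions -/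

/-- Support-restricted congruence for `PMF.bind` (two kernels that agree on the support of `p`
give the same compound distribution). [folklore] -/
theorem pmf_bind_congr_of_mem_support {α β : Type*} (p : PMF α) {f g : α → PMF β}
    (h : ∀ a ∈ p.support, f a = g a) : p.bind f = p.bind g := by
  ext b
  simp only [PMF.bind_apply]
  refine tsum_congr fun a => ?_
  by_cases ha : a ∈ p.support
  · rw [h a ha]
  · rw [PMF.mem_support_iff, not_not] at ha
    simp [ha]

/-- Strings in the support of `U_m` have length `m`. [Goldreich 2001, §1.3 (`U_n`)] [cite: Goldreich2001, §1.3] -/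
theorem length_eq_of_mem_support_uniformBits {m : ℕ} {s : List Bool}
    (hs : s ∈ (uniformBits m).support) : s.length = m := by
  rw [uniformBits, PMF.mem_support_map_iff] at hs
  obtain ⟨v, -, rfl⟩ := hs
  exact v.toList_length

/-- **`U_{m+1}` without its last bit is `U_m`.** [folklore] -/
theorem uniformBits_succ_map_dropLast (m : ℕ) :
    (uniformBits (m + 1)).map List.dropLast = uniformBits m := by
  rw [uniformBits, uniformBits, PMF.map_comp]
  have h : (List.dropLast ∘ List.Vector.toList : List.Vector Bool (m + 1) → List Bool) =
      fun r => r.toList.take m := by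
    funext r
    simp [Function.comp_apply, List.dropLast_eq_take, r.toList_length]
  rw [h]
  exact Literature.Computability.MetaComplexity.map_take_uniformOfFintype_vector (Nat.le_succ m)

/-- Removing the last symbol of a game input `⟨1ⁿ, s⟩` with `s ≠ []` removes the last symbol of
`s`. [Arora–Barak 2009, §0.1 (pairing)] [cite: AroraBarak2009, §0.1] -/
theorem dropLast_boolPair_of_ne_nil (u : List Bool) {s : List Bool} (hs : s ≠ []) :
    (boolPair u s).dropLast = boolPair u s.dropLast := by
  simp [boolPair, List.dropLast_cons_of_ne_nil hs]

/-- **Acceptance of `lift D` on a sampled ensemble** whose samples are nonempty equals acceptance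
of `D` on the truncated samples. [Goldreich 2001, Def. 3.2.2] [cite: Goldreich2001, Def. 3.2.2] -/
theorem acceptPMF_lift_of_ne_nil (D : RandAlg (List Bool) Bool) (n : ℕ) (X : PMF (List Bool))
    (hX : ∀ s ∈ X.support, s ≠ []) :
    acceptPMF (lift D) n X = acceptPMF D n (X.map List.dropLast) := by
  rw [acceptPMF, acceptPMF, PMF.bind_map]
  refine pmf_bind_congr_of_mem_support X fun s hs => ?_
  rw [outputPMF_lift, Function.comp_apply, dropLast_boolPair_of_ne_nil _ (hX s hs)]

/-- Acceptance of `lift D` on `G(U_n)` equals acceptance of `D` on `G(U_n)` truncated, when `G`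
never outputs the empty string. [Goldreich 2001, Def. 3.2.2, Def. 3.3.1] [cite: Goldreich2001, Def. 3.3.1] -/
theorem acceptPMF_lift_map (D : RandAlg (List Bool) Bool) (n : ℕ) {G : List Bool → List Bool}
    (hG : ∀ s, G s ≠ []) :
    acceptPMF (lift D) n ((uniformBits n).map G) =
      acceptPMF D n ((uniformBits n).map fun s => (G s).dropLast) := by
  rw [acceptPMF_lift_of_ne_nil D n _ fun s hs => ?_, PMF.map_comp]
  · rfl
  · obtain ⟨u, -, rfl⟩ := (PMF.mem_support_map_iff _ _ _).1 hs
    exact hG u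

/-- Acceptance of `lift D` on `U_{m+1}` equals acceptance of `D` on `U_m`.
[Goldreich 2001, Def. 3.2.2, §1.3] [cite: Goldreich2001, Def. 3.2.2] -/
theorem acceptPMF_lift_uniformBits (D : RandAlg (List Bool) Bool) (n m : ℕ) :
    acceptPMF (lift D) n (uniformBits (m + 1)) = acceptPMF D n (uniformBits m) := by
  rw [acceptPMF_lift_of_ne_nil D n _ fun s hs => ?_, uniformBits_succ_map_dropLast]
  intro h
  have := length_eq_of_mem_support_uniformBits hs
  rw [h] at this
  exact Nat.succ_ne_zero m this.symm

/-- **The advantages agree**: against `lift D`, the ensemble `G(U_n)` versus `U_{ℓ' n + 1}` has the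
advantage of `D` against the truncated generator versus `U_{ℓ' n}`.
[Goldreich 2001, Def. 3.2.2, Def. 3.3.1] [cite: Goldreich2001, Def. 3.3.1] -/
theorem distAdvantage_lift (D : RandAlg (List Bool) Bool) {G : List Bool → List Bool}
    (hG : ∀ s, G s ≠ []) {ℓ ℓ' : ℕ → ℕ} (hℓ : ∀ n, ℓ n = ℓ' n + 1) (n : ℕ) :
    distAdvantage (lift D) (fun n => (uniformBits n).map G) (uniformEnsemble ℓ) n =
      distAdvantage D (fun n => (uniformBits n).map fun s => (G s).dropLast)
        (uniformEnsemble ℓ') n := by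
  simp only [distAdvantage, uniformEnsemble, hℓ, acceptPMF_lift_map D n hG,
    acceptPMF_lift_uniformBits]

end PRGTrunc

open PRGTrunc

/-! ### Truncated generators -/

/-- **Pseudorandomness survives truncation by one symbol**: if `G(U_n)` is pseudorandom against
`U_{ℓ' n + 1}` and `G` never outputs the empty string, then `G(U_n)` minus its last symbol is
pseudorandom against `U_{ℓ' n}` (a distinguisher for the latter, lifted by `PRGTrunc.lift`, has the
same advantage against the former). [Goldreich 2001, Def. 3.3.1, §3.3.3 (prefixes of pseudorandom
sequences)] [folklore] -/
theorem IsPseudorandom.map_dropLast {G : List Bool → List Bool} {ℓ ℓ' : ℕ → ℕ}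
    (h : IsPseudorandom (fun n => (uniformBits n).map G) ℓ) (hG : ∀ s, G s ≠ [])
    (hℓ : ∀ n, ℓ n = ℓ' n + 1) :
    IsPseudorandom (fun n => (uniformBits n).map fun s => (G s).dropLast) ℓ' := by
  intro D hD
  have h' := h (lift D) (isPPT_lift hD)
  have heq : distAdvantage (lift D) (fun n => (uniformBits n).map G) (uniformEnsemble ℓ) =
      distAdvantage D (fun n => (uniformBits n).map fun s => (G s).dropLast) (uniformEnsemble ℓ') :=
    funext (distAdvantage_lift D hG hℓ)
  rwa [heq] at h'

/-- **Truncating a PRG by one symbol**: if `G` is a pseudorandom generator with stretch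
`ℓ = ℓ' + 1`, then `s ↦ (G s).dropLast` is polynomial-time computable, has output length
`ℓ' |s|`, and `n ↦ (G(U_n)).dropLast` is pseudorandom against `U_{ℓ' n}` — the three clauses of
`IsPRG`/`IsLengthDoublingPRG` other than expansion. [Goldreich 2001, Def. 3.3.1, §3.3.2–3.3.3] [folklore] -/
theorem IsPRG.dropLast {G : List Bool → List Bool} {ℓ ℓ' : ℕ → ℕ} (h : IsPRG G ℓ)
    (hℓ : ∀ n, ℓ n = ℓ' n + 1) :
    PolyTimeComputable (id : List Bool → List Bool) (id : List Bool → List Bool)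
        (fun s => (G s).dropLast) ∧
      (∀ s, ((G s).dropLast).length = ℓ' s.length) ∧
        IsPseudorandom (fun n => (uniformBits n).map fun s => (G s).dropLast) ℓ' := by
  obtain ⟨hc, -, hlen, hps⟩ := h
  have hG : ∀ s, G s ≠ [] := fun s h0 => by
    have := hlen s
    rw [h0, hℓ] at this
    exact Nat.succ_ne_zero _ this.symm
  exact ⟨polyTimeComputable_dropLast_comp hc, fun s => by rw [List.length_dropLast, hlen, hℓ]; rfl,
    hps.map_dropLast hG hℓ⟩

/-- **A PRG of stretch `ℓ' + 1` yields a PRG of stretch `ℓ'`** (when `ℓ'` is still expanding).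
[Goldreich 2001, Def. 3.3.1, §3.3.2] [folklore] -/
theorem IsPRG.isPRG_dropLast {G : List Bool → List Bool} {ℓ ℓ' : ℕ → ℕ} (h : IsPRG G ℓ)
    (hℓ : ∀ n, ℓ n = ℓ' n + 1) (hlt : ∀ n, n < ℓ' n) : IsPRG (fun s => (G s).dropLast) ℓ' := by
  obtain ⟨h₁, h₂, h₃⟩ := h.dropLast hℓ
  exact ⟨h₁, hlt, h₂, h₃⟩

/-- **A PRG of stretch `2n + 1` yields a length-doubling PRG** (the hypothesis of the GGM
construction). [Goldreich 2001, Def. 3.3.1 with Construction 3.6.5] [folklore] -/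
theorem IsPRG.isLengthDoublingPRG_dropLast {G : List Bool → List Bool}
    (h : IsPRG G fun n => 2 * n + 1) : IsLengthDoublingPRG fun s => (G s).dropLast :=
  h.dropLast fun _ => rfl

/-! ### The stretch `n ↦ 2n + 1` is polynomial-time computable in unary -/

namespace GGM

/-- The transducer `1ⁿ ↦ 1^{2n+1}`: each symbol is emitted twice and one more `1` is put in
front. [folklore] -/
def twiceSuccT : FST Unit Bool Bool where
  init := ()
  step := fun _ _ => ((), [true, true])
  front := fun _ => [true]
  keep := fun _ => true

/-- `1^{2n}` is `1ⁿ` with every symbol doubled. [folklore] -/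
theorem unaryEncodeNat_two_mul (n : ℕ) :
    unaryEncodeNat (2 * n) = (unaryEncodeNat n).flatMap fun _ => [true, true] := by
  induction n with
  | zero => rfl
  | succ n ih =>
    rw [show 2 * (n + 1) = 2 * n + 1 + 1 by ring]
    simp [unaryEncodeNat, ih]

/-- The body emitted by `twiceSuccT` doubles every symbol. [folklore] -/
theorem twiceSuccT_run (l : List Bool) :
    (twiceSuccT.run () l).2 = l.flatMap fun _ => [true, true] := by
  induction l with
  | nil => rfl
  | cons b l ih => simp [FST.run_cons, twiceSuccT] at ih ⊢; simp [ih]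

/-- **`twiceSuccT 1ⁿ = 1^{2n+1}`.** [folklore] -/
theorem twiceSuccT_eval (n : ℕ) :
    twiceSuccT.eval (unaryEncodeNat n) = unaryEncodeNat (2 * n + 1) := by
  have he : twiceSuccT.eval (unaryEncodeNat n) = true :: (twiceSuccT.run () (unaryEncodeNat n)).2 := by
    simp [FST.eval, twiceSuccT]
  rw [he, twiceSuccT_run, show 2 * n + 1 = (2 * n) + 1 from rfl, unaryEncodeNat,
    unaryEncodeNat_two_mul]

/-- **The stretch function `n ↦ 2n + 1` is polynomial-time computable in unary** (as required
by the stretch-extension theorem, `Literature.Computability.Cryptography.exists_isPRG_of_stretch_succ`).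
[Goldreich 2001, §3.3.2 (Construction 3.3.2: the stretch `p(n)` is computed from `1ⁿ`)] [folklore] -/
theorem polyTimeComputable_two_mul_add_one :
    PolyTimeComputable unaryEncodeNat unaryEncodeNat fun n : ℕ => 2 * n + 1 :=
  twiceSuccT.polyTimeComputable_eval.of_comp_encode unaryEncodeNat (fun _ => rfl)
    fun n => by rw [id, twiceSuccT_eval]

end GGM

/-! ### The Main Theorem (named fact) and its consequences -/

/-- **GGM Main Theorem** (pseudorandomness of the construction). Let `G` be a length-doubling
pseudorandom generator and `F = ggmEnsemble G` the collection of §3.2. Then `F` passes all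
polynomial-time statistical tests for functions: for every probabilistic polynomial-time oracle
machine `𝒜`, `|Pr_{k ← U_n}[𝒜^{f_k}(1ⁿ) = 1] − Pr_{H}[𝒜^{H}(1ⁿ) = 1]|` (`H` a uniformly random
function `{0,1}ⁿ → {0,1}ⁿ`) is smaller than `1/Q(n)` for every polynomial `Q` and all large `n`
(negligible, `SuperpolynomialDecay`). Proof in print: level hybrids `A_i`, lazy sampling, and a
string test `A_T` on polynomially many samples, then Thm. 1.
[GGM 1986, §3.3, Thm. 3 (Main Theorem), p. 800, proof pp. 800–802; Goldreich 2001, Thm. 3.6.6] [cite: GGM1986, Thm. 3] -/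
def GGM1986_thm3 : Prop :=
  ∀ G : List Bool → List Bool, IsLengthDoublingPRG G →
    ∀ 𝒜 : OracleAdversary Bool, 𝒜.IsPPT encodingBoolBool →
      SuperpolynomialDecay atTop (fun n : ℕ => (n : ℝ)) (prfAdvantage (ggmEnsemble G) id id id 𝒜)

/-- **Goldreich 2001, Thm. 3.6.6** assembled from the proved efficiency and the Main Theorem
(named fact): if `G` is a length-doubling pseudorandom generator then `ggmEnsemble G` is a
(length-preserving) pseudorandom function ensemble. [Goldreich 2001, Thm. 3.6.6; GGM 1986, Thm. 3 with §3.3] [cite: Goldreich2001, Thm. 3.6.6] -/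
theorem isPRF_ggmEnsemble (h : GGM1986_thm3) {G : List Bool → List Bool}
    (hG : IsLengthDoublingPRG G) : IsPRF (ggmEnsemble G) id id id :=
  ⟨isEfficientFamily_ggmEnsemble hG.polyTimeComputable hG.length_eq, h G hG⟩

/-- **The existence corollary** (the correct conditional reading of `PRFExist`'s GGM citation):
given the Main Theorem, a length-doubling pseudorandom generator yields `PRFExist`.
[GGM 1986, Thm. 3; Goldreich 2001, Thm. 3.6.6 and Cor. 3.6.7–3.6.8] [cite: GGM1986, Thm. 3] -/
theorem PRFExist_of_exists_isLengthDoublingPRG (h : GGM1986_thm3)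
    (hG : ∃ G, IsLengthDoublingPRG G) : PRFExist := by
  obtain ⟨G, hG⟩ := hG
  exact ⟨ggmEnsemble G, isPRF_ggmEnsemble h hG⟩

/-- Given the Main Theorem, a pseudorandom generator of stretch `2n + 1` (in the prelude's sense
`IsPRG`) yields `PRFExist`: truncate it to a length-doubling one
(`IsPRG.isLengthDoublingPRG_dropLast`) and apply the construction.
[GGM 1986, Thm. 3; Goldreich 2001, Thm. 3.6.6] [cite: GGM1986, Thm. 3] -/
theorem PRFExist_of_exists_isPRG_two_mul_add_one (h : GGM1986_thm3)
    (hG : ∃ G, IsPRG G fun n => 2 * n + 1) : PRFExist := by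
  obtain ⟨G, hG⟩ := hG
  exact PRFExist_of_exists_isLengthDoublingPRG h ⟨_, hG.isLengthDoublingPRG_dropLast⟩

/-- **`PRFExist` from a one-bit-stretch PRG, modulo the two named facts of the chain**: the
stretch-extension theorem (Goldreich 2001, Thm. 3.3.3, the named fact
`Literature.Computability.Cryptography.exists_isPRG_of_stretch_succ`, applied with the stretch `2n + 1`, which is
polynomially bounded, expanding and unary-polynomial-time, `GGM.polyTimeComputable_two_mul_add_one`)
and the GGM Main Theorem. This is the precise conditional content behind the citation formerly
attached to `PRFExist`. [Goldreich 2001, Thm. 3.3.3 and Thm. 3.6.6; GGM 1986, Thm. 3] [cite: Goldreich2001, Thm. 3.6.6] -/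
theorem PRFExist_of_exists_isPRG_succ (h : GGM1986_thm3)
    (h₃ : Literature.Computability.Cryptography.exists_isPRG_of_stretch_succ) (hG : ∃ G, IsPRG G (· + 1)) :
    PRFExist :=
  PRFExist_of_exists_isPRG_two_mul_add_one h
    (h₃ hG (fun n => 2 * n + 1) ⟨2 * Polynomial.X + 1, fun n => by simp⟩ (fun n => by omega)
      GGM.polyTimeComputable_two_mul_add_one)

end Literature.Computability.Cryptography
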